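import Literature.NumberTheory.EllipticCurves.ShaRestrictionJZeroDescent
import Literature.NumberTheory.GaloisRepresentations.EisensteinCubicIndex
import Literature.NumberTheory.EllipticCurves.ComplexMultiplicationDeuring0Square
import Literature.NumberTheory.EllipticCurves.LFunctionPrimeCoeff
import Literature.NumberTheory.EllipticCurves.OrdinaryPrimesProofs
import Literature.NumberTheory.EllipticCurves.HeegnerPoints
import Mathlib.NumberTheory.NumberField.Cyclotomic.Basic
import HarnessLib

/-!
# The field `K = ℚ(ω)` (`ω² + ω + 1 = 0`, `[K:ℚ] = 2`): `K` is the third cyclotomic field, `d_K = −3`,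
# `K` is imaginary quadratic; the Kolyvagin primes `ℓ ≡ 2 (mod 3)` of the `j = 0` curves: `(ℓ)` is prime
# in `𝓞_K` and `a_ℓ(E) = 0`

Topic `NumberTheory/EllipticCurves`, namespace `Literature.NumberTheory.EllipticCurves.JZero`. THEOREMS ONLY
(no definition, no named fact, no instance, no notation; D-0014/D-0026). Cell `bsd-cm`, row `bsd-cm-k-ty1`
((M1)(K-ty) arithmetic wrapper for VARIANT K on crux 19804 `UpperOffV0HSYPlus`), fourth seating, FILE 2 of
planner ruling D413; `--supports stmt-BirchSwinnertonDyer-19804`. GLUE between the route's binder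
convention `(K, ω, ω² + ω + 1 = 0, [K:ℚ] = 2)` (`JZero.exists_aut_apply_eq_sq`, the USER GUIDE of
`SPEC-K-TY`) and the hypotheses of the Euler-system / class-field-theory files of the line:
`HuShuYin2019.sum_pointGalHom_eq_lFunction_smul_sylvesterTower` (`hK : IsImaginaryQuadratic K`,
`hdK : NumberField.discr K = −3`, `hinert : (ℓ𝓞_K).IsPrime`, `a_ℓ = W.LFunction ℓ`) and
`HuShuYin2019.pow_three_ne_six_of_forall_apply_eq` / `…SylvesterTowerTwoTorsion` (`hK`, `Odd d_K`).

WHAT IS PROVED (sorry-free):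

* §1 the field: `algebraMap_ne_of_sq_add_self_add_one` (`ω ∉ ℚ`), `adjoin_eq_top_of_sq_add_self_add_one`
  (`K = ℚ(ω)`), `isCyclotomicExtension_three_of_sq_add_self_add_one` (`K/ℚ` is the third cyclotomic extension),
  **`discr_eq_neg_three_of_sq_add_self_add_one`** (`d_K = −3`; Mathlib `IsCyclotomicExtension.Rat.discr_prime`: `d(ℚ(ζ_p)) =
  (−1)^{(p−1)/2} p^{p−2}`, Washington Prop. 2.7), `odd_discr_of_sq_add_self_add_one`, `isImaginaryQuadratic_of_sq_add_self_add_one`, `isGalois_of_sq_add_self_add_one`.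
* §2 the Kolyvagin primes are inert: **`span_natCast_isPrime_of_mod_three_eq_two`** — for a prime
  `ℓ ≡ 2 (mod 3)` the ideal `ℓ𝓞_K` is prime (`ℓ` inert in `K`; Ireland–Rosen Prop. 9.1.4; the tree's
  `EisensteinCubic.isPrime_span_natCast` for `IsCyclotomicExtension {3} ℚ K`, via Mathlib's cyclotomic
  splitting law), and `prime_natCast_of_mod_three_eq_two`.
* §3 supersingularity: **`lFunction_eq_zero_of_j_eq_zero_of_mod_three_eq_two`** — for `W/ℚ` a global minimal
  model with `j = 0` and a prime `ℓ ≡ 2 (mod 3)`, `ℓ ≠ 2`, with `ℓ ∤ Δ_min(W)`: the `ℓ`-th coefficient of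
  `L(W, s)` vanishes, `a_ℓ = 0` (Deuring; Ireland–Rosen Ch. 18 §3: `N_ℓ = ℓ + 1` for `y² = x³ + D`,
  `ℓ ≡ 2 (mod 3)`; the tree's `frobeniusTrace_eq_zero_of_j_eq_zero_of_mod_three_eq_two` +
  `LFunction_apply_prime_eq_frobeniusTrace` + `hasGoodReductionAtPrime_of_not_dvd`). With `2^M ∣ ℓ + 1` this
  makes `ℓ` a Kolyvagin prime of the `2`-adic CM-frame argument (memo two §57.3, `𝒮₁(M)`), and `a_ℓ = 0`
  turns (ES1) `Tr y_{nℓ} = a_ℓ · y_n` (Gross 1991 Prop. 3.7 (1)) into `Tr y_{nℓ} = 0`.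

HONEST FRAMING: elementary algebraic number theory of `ℚ(√−3)` and Deuring's supersingularity criterion, all
already PROVED in the tree/Mathlib and only re-keyed here; nothing about Selmer groups, `Ш` or BSD is asserted;
no summit statement is touched.

## References

* K. Ireland, M. Rosen, *A Classical Introduction to Modern Number Theory*, 2nd ed., GTM 84 (1990),
  Prop. 9.1.4 (primes in `ℤ[ω]`: `q ≡ 2 (mod 3)` is inert), Ch. 18 §3 (`y² = x³ + D` at `p ≡ 2 (mod 3)`).
  [IrelandRosen1990]
* L. C. Washington, *Introduction to Cyclotomic Fields*, 2nd ed., GTM 83 (1997), Prop. 2.7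
  (discriminant of `ℚ(ζ_p)`). [Washington1997]
* B. H. Gross, *Kolyvagin's work on modular elliptic curves*, LMS LN 153 (1991), §3 (3.3), Prop. 3.7 (1).
  [GrossLMS1991]
* Y. Hu, J. Shu, H. Yin, *An explicit Gross–Zagier formula related to the Sylvester conjecture*,
  Trans. AMS 372 (2019); arXiv:1708.05266, §1–§2 (`K = ℚ(√−3)`, `ω`). [HuShuYin2019]

## Mathlib / tree search
Tree: `JZero.exists_aut_apply_eq_sq` (`IsPrimitiveRoot ω 3`, complex places; `ShaRestrictionJZeroDescent`),
`EisensteinCubic.isPrime_span_natCast` / `prime_natCast` (`EisensteinCubicIndex`),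
`frobeniusTrace_eq_zero_of_j_eq_zero_of_mod_three_eq_two` (`ComplexMultiplicationDeuring0Square`),
`WeierstrassCurve.LFunction_apply_prime_eq_frobeniusTrace` (`LFunctionPrimeCoeff`),
`WeierstrassCurve.hasGoodReductionAtPrime_of_not_dvd` (`OrdinaryPrimesProofs`); Mathlib:
`IsCyclotomicExtension.iff_adjoin_eq_top`, `IsCyclotomicExtension.Rat.discr_prime`,
`IsCyclotomicExtension.isGalois`, `IntermediateField.eq_of_le_of_finrank_eq`, `IntermediateField.finrank_eq_one_iff`.
`lean search 'discr K = -3'` → only Summits-side `discr_cyclotomicField_three` (QuantumAdvantage) for the concrete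
`CyclotomicField 3 ℚ`; nothing keyed on `(ω, [K:ℚ] = 2)`.
-/

noncomputable section

open NumberField IntermediateField

namespace Literature.NumberTheory.EllipticCurves.JZero

open Literature.NumberTheory.EllipticCurves Literature.NumberTheory.GaloisRepresentations WeierstrassCurve

variable {K : Type} [Field K] [NumberField K]

/-! ### §1. The field `ℚ(ω)`: `K = ℚ(ω)` is the third cyclotomic field, `d_K = −3` -/

/-- `ω ∉ ℚ`: no rational number satisfies `q² + q + 1 = 0` (`(2q + 1)² + 3 = 4(q² + q + 1)`).
[cite: HuShuYin2019, §1 (K = ℚ(√−3) = ℚ(ω))] -/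
theorem algebraMap_ne_of_sq_add_self_add_one {ω : K} (hω : ω ^ 2 + ω + 1 = 0) (q : ℚ) :
    algebraMap ℚ K q ≠ ω := by
  intro h
  have hq : algebraMap ℚ K (q ^ 2 + q + 1) = algebraMap ℚ K 0 := by
    rw [map_add, map_add, map_pow, map_one, h, hω, map_zero]
  have hq0 : q ^ 2 + q + 1 = 0 := (algebraMap ℚ K).injective hq
  nlinarith [sq_nonneg (2 * q + 1)]

/-- **`K = ℚ(ω)`**: for `[K : ℚ] = 2` and `ω ∈ K` with `ω² + ω + 1 = 0`, `ℚ⟮ω⟯ = K` (`ω ∉ ℚ`, so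
`[ℚ(ω) : ℚ] ∉ {1}` divides `2`). [cite: HuShuYin2019, §1 (K = ℚ(√−3) = ℚ(ω))] -/
theorem adjoin_eq_top_of_sq_add_self_add_one {ω : K} (hω : ω ^ 2 + ω + 1 = 0)
    (h2 : Module.finrank ℚ K = 2) : ℚ⟮ω⟯ = ⊤ := by
  have hne : ℚ⟮ω⟯ ≠ ⊥ := by
    intro hbot
    have hmem : ω ∈ (⊥ : IntermediateField ℚ K) := hbot ▸ mem_adjoin_simple_self ℚ ω
    rw [IntermediateField.mem_bot] at hmem
    obtain ⟨q, hq⟩ := hmem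
    exact algebraMap_ne_of_sq_add_self_add_one hω q hq
  have h1 : Module.finrank ℚ ℚ⟮ω⟯ ≠ 1 := fun h ↦ hne (IntermediateField.finrank_eq_one_iff.mp h)
  have hdvd : Module.finrank ℚ ℚ⟮ω⟯ ∣ 2 := by
    rw [← h2, ← Module.finrank_mul_finrank ℚ ℚ⟮ω⟯ K]
    exact dvd_mul_right _ _
  have hle : Module.finrank ℚ ℚ⟮ω⟯ ≤ 2 := Nat.le_of_dvd two_pos hdvd
  have hpos : 0 < Module.finrank ℚ ℚ⟮ω⟯ := Module.finrank_pos
  have h2' : Module.finrank ℚ ℚ⟮ω⟯ = 2 := by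
    interval_cases h : Module.finrank ℚ ℚ⟮ω⟯
    · exact absurd rfl h1
    · rfl
  exact IntermediateField.eq_of_le_of_finrank_eq le_top
    (by rw [h2', IntermediateField.finrank_top', h2])

/-- **`K/ℚ` is the third cyclotomic extension** (`IsCyclotomicExtension {3} ℚ K`): `ω` is a primitive
cube root of unity (`JZero.exists_aut_apply_eq_sq`) and generates `K`.
[cite: HuShuYin2019, §1 (K = ℚ(√−3) = ℚ(ω))] [cite: Washington1997, Ch. 2 (ℚ(ζ_n))] -/
theorem isCyclotomicExtension_three_of_sq_add_self_add_one {ω : K} (hω : ω ^ 2 + ω + 1 = 0)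
    (h2 : Module.finrank ℚ K = 2) : IsCyclotomicExtension {3} ℚ K := by
  have hζ : IsPrimitiveRoot ω 3 := (exists_aut_apply_eq_sq K hω h2).1
  rw [IsCyclotomicExtension.iff_adjoin_eq_top]
  refine ⟨fun n hn _ ↦ ⟨ω, by rw [Set.mem_singleton_iff.mp hn]; exact hζ⟩, ?_⟩
  rw [eq_top_iff, ← IntermediateField.top_toSubalgebra, ← adjoin_eq_top_of_sq_add_self_add_one hω h2,
    IntermediateField.adjoin_simple_toSubalgebra_of_isAlgebraic (Algebra.IsAlgebraic.isAlgebraic ω)]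
  refine Algebra.adjoin_mono fun b hb ↦ ?_
  rw [Set.mem_singleton_iff] at hb
  subst hb
  exact ⟨3, Set.mem_singleton 3, three_ne_zero, hζ.pow_eq_one⟩

/-- **`d_K = −3`** for `K = ℚ(ω)`, `[K:ℚ] = 2`, `ω² + ω + 1 = 0` (`d(ℚ(ζ_p)) = (−1)^{(p−1)/2} p^{p−2}`
at `p = 3`; Mathlib `IsCyclotomicExtension.Rat.discr_prime`). This is the hypothesis `hdK` of
`HuShuYin2019.sum_pointGalHom_eq_lFunction_smul_sylvesterTower`. [cite: Washington1997, Prop. 2.7]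
[cite: HuShuYin2019, §1 (K = ℚ(√−3))] -/
theorem discr_eq_neg_three_of_sq_add_self_add_one {ω : K} (hω : ω ^ 2 + ω + 1 = 0) (h2 : Module.finrank ℚ K = 2) :
    NumberField.discr K = -3 := by
  haveI := isCyclotomicExtension_three_of_sq_add_self_add_one hω h2
  haveI : Fact (Nat.Prime 3) := ⟨Nat.prime_three⟩
  have h := IsCyclotomicExtension.Rat.discr_prime 3 K
  rw [h]
  norm_num

/-- `d_K` is odd (`= −3`): `2` is unramified in `K = ℚ(ω)` — the hypothesis `hdK : Odd (NumberField.discr K)`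
of `HuShuYin2019/SylvesterTowerTwoTorsion.lean`. [cite: Washington1997, Prop. 2.7] -/
theorem odd_discr_of_sq_add_self_add_one {ω : K} (hω : ω ^ 2 + ω + 1 = 0) (h2 : Module.finrank ℚ K = 2) :
    Odd (NumberField.discr K) :=
  ⟨-2, by rw [discr_eq_neg_three_of_sq_add_self_add_one hω h2]; norm_num⟩

/-- **`K = ℚ(ω)` is imaginary quadratic** (`[K:ℚ] = 2`, every infinite place complex —
`JZero.exists_aut_apply_eq_sq`): the hypothesis `hK` of the ring-class-field files.
[cite: HuShuYin2019, §1 (K = ℚ(√−3))] -/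
theorem isImaginaryQuadratic_of_sq_add_self_add_one {ω : K} (hω : ω ^ 2 + ω + 1 = 0) (h2 : Module.finrank ℚ K = 2) :
    IsImaginaryQuadratic K :=
  ⟨h2, ⟨(exists_aut_apply_eq_sq K hω h2).2.1⟩⟩

/-- `K = ℚ(ω)` is Galois over `ℚ` (cyclotomic). [cite: Washington1997, Ch. 2 (ℚ(ζ_n)/ℚ is Galois)] -/
theorem isGalois_of_sq_add_self_add_one {ω : K} (hω : ω ^ 2 + ω + 1 = 0) (h2 : Module.finrank ℚ K = 2) : IsGalois ℚ K := by
  haveI := isCyclotomicExtension_three_of_sq_add_self_add_one hω h2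
  exact IsCyclotomicExtension.isGalois {3} ℚ K

/-! ### §2. Primes `ℓ ≡ 2 (mod 3)` are inert in `K` -/

/-- **`ℓ𝓞_K` is a prime ideal for a prime `ℓ ≡ 2 (mod 3)`** (`ℓ` is inert in `K = ℚ(ω)`;
Ireland–Rosen Prop. 9.1.4 (b); the tree's `EisensteinCubic.isPrime_span_natCast` for
`IsCyclotomicExtension {3} ℚ K`, re-keyed on `(ω, [K:ℚ] = 2)`). This is the hypothesis `hinert` of
`HuShuYin2019.sum_pointGalHom_eq_lFunction_smul_sylvesterTower` (the Kolyvagin prime `λ = (ℓ)`,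
Gross 1991 §3). [cite: IrelandRosen1990, Prop. 9.1.4] [cite: GrossLMS1991, §3 (λ = ℓ𝒪_K)] -/
theorem span_natCast_isPrime_of_mod_three_eq_two {ω : K} (hω : ω ^ 2 + ω + 1 = 0)
    (h2 : Module.finrank ℚ K = 2) {ℓ : ℕ} (hℓ : ℓ.Prime) (hℓ3 : ℓ % 3 = 2) :
    (Ideal.span {(ℓ : 𝓞 K)}).IsPrime := by
  haveI := isCyclotomicExtension_three_of_sq_add_self_add_one hω h2
  exact EisensteinCubic.isPrime_span_natCast hℓ hℓ3

/-- `ℓ` is a prime element of `𝓞 K` for a prime `ℓ ≡ 2 (mod 3)` (`K = ℚ(ω)`).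
[cite: IrelandRosen1990, Prop. 9.1.4] -/
theorem prime_natCast_of_mod_three_eq_two {ω : K} (hω : ω ^ 2 + ω + 1 = 0)
    (h2 : Module.finrank ℚ K = 2) {ℓ : ℕ} (hℓ : ℓ.Prime) (hℓ3 : ℓ % 3 = 2) :
    Prime (ℓ : 𝓞 K) := by
  haveI := isCyclotomicExtension_three_of_sq_add_self_add_one hω h2
  exact EisensteinCubic.prime_natCast hℓ hℓ3

/-! ### §3. `a_ℓ(E) = 0` for `j(E) = 0` at a good prime `ℓ ≡ 2 (mod 3)` -/

/-- **`a_ℓ = 0` in `L(E, s)` for `j(E) = 0` and `ℓ ≡ 2 (mod 3)` a good odd prime.** For a global minimal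
model `W/ℚ` with `j = 0` and a prime `ℓ ≡ 2 (mod 3)`, `ℓ ≠ 2`, `ℓ ∤ Δ_min(W)`: the `ℓ`-th Dirichlet
coefficient of `L(W, s)` is `0` (`E` has good SUPERSINGULAR reduction at `ℓ`: `#Ẽ(𝔽_ℓ) = ℓ + 1`, since
`x ↦ x³` permutes `𝔽_ℓ` — Ireland–Rosen Ch. 18 §3; Deuring). In the `2`-adic CM-frame argument for
`E_9 : x³ + y³ = 9` this is the vanishing `a_ℓ(E_9) = 0` at the Kolyvagin primes `ℓ ≡ 2 (mod 3)`,
`ℓ ∤ 6p` under which (ES1) reads `Tr_{H_{9pnℓ}/H_{9pn}} y_{nℓ} = 0`.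
[cite: IrelandRosen1990, Ch. 18 §3 (y² = x³ + D, p ≡ 2 (mod 3): N_p = p + 1)]
[cite: GrossLMS1991, §3 (3.3) and Prop. 3.7 (1)] -/
theorem lFunction_eq_zero_of_j_eq_zero_of_mod_three_eq_two (W : WeierstrassCurve ℚ) [W.IsElliptic]
    [W.IsGloballyMinimal] (hj : W.j = 0) {ℓ : ℕ} (hℓ : ℓ.Prime) (hℓ3 : ℓ % 3 = 2) (hℓ2 : ℓ ≠ 2)
    (hΔ : ¬ (ℓ : ℤ) ∣ minimalDiscriminantInt W) : W.LFunction ℓ = 0 := by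
  haveI : Fact ℓ.Prime := ⟨hℓ⟩
  rw [W.LFunction_apply_prime_eq_frobeniusTrace ℓ (W.hasGoodReductionAtPrime_of_not_dvd ℓ hΔ),
    frobeniusTrace_eq_zero_of_j_eq_zero_of_mod_three_eq_two W hj hℓ hℓ3 hℓ2 hΔ]

end Literature.NumberTheory.EllipticCurves.JZero
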